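import Literature.Geometry.Riemannian.KillingHopfPositive
import Literature.Geometry.Riemannian.HamiltonPCOClassificationProofs
import HarnessLib

/-!
# `hamilton_positiveCurvatureOperator_classification_four` reduced to the convergence of the
# Ricci flow alone: the Killing–Hopf input (H2) is proved
(topic `Geometry/Riemannian`; companion of `HamiltonPCOClassificationProofs.lean`)

`HamiltonPCOClassificationProofs.lean` factors the named fact
`Literature.Geometry.Riemannian.hamilton_positiveCurvatureOperator_classification_four`
(**Hamilton 1986, Thm. 1.1**: a compact four-manifold with positive curvature operator is
diffeomorphic to `S⁴` or `RP⁴`) as Thm. 1.1 ⇐ (H1) ∧ (H2), with (H1) = convergence of the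
normalised Ricci flow to constant positive sectional curvature (Hamilton 1986, p. 154 with 5.2 and
Thm. 7.1) and (H2) = the Killing–Hopf theorem in quotient form for closed 4-manifolds of constant
curvature `c > 0` (Lee 2018, Thm. 12.4, Cor. 12.5). (H2) is now a theorem of the tree
(`KillingHopf.exists_orthogonal_quotient`, `KillingHopfPositive.lean`, over `SphereGeodesics`,
`ConstantCurvatureJacobi`, `LocalIsometryRigidity`, `SphereLocalIsometry`), so:

* `killingHopf_quotient_four` — (H2) verbatim, PROVED;
* `hamilton_positiveCurvatureOperator_classification_four_of_constantCurvature` —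
  **Thm. 1.1 ⇐ (H1)**: the only remaining input of the named fact is the long-time existence and
  convergence of the normalised Ricci flow on compact 4-manifolds of positive curvature operator
  (whose ODE part, Thm. 7.1, is in the tree: `HamiltonPCOPinching*.lean`; whose PDE part needs
  `ricciFlow_shortTime_existence`, the maximum principle `hamilton_maximumPrinciple_curvatureODE_holds`
  and Hamilton 1982, §§10–17).

No named facts (D-0026).

## References

* R. S. Hamilton, *Four-manifolds with positive curvature operator*, J. Differential Geom. 24
  (1986) 153–179: Thm. 1.1 (p. 153), p. 154, 5.2, Thm. 7.1. [Hamilton1986]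
* J. M. Lee, *Introduction to Riemannian Manifolds*, 2nd ed. (2018), Thm. 12.4, Cor. 12.5,
  Problem 12-2. [Lee2018]
-/

noncomputable section

open Set Function Metric Module
open scoped Manifold ContDiff

namespace Literature.Geometry.Riemannian

open Lorentzian Lorentzian.PseudoRiemannianMetric

/-- **Killing–Hopf in dimension four, quotient form** — hypothesis (H2) of
`hamilton_positiveCurvatureOperator_classification_four_of_constantCurvature_of_killingHopf`
(`HamiltonPCOClassificationProofs.lean`), now a theorem: a closed connected smooth 4-manifold with
a `C^∞` Riemannian metric of constant sectional curvature `c > 0` is a free orthogonal quotient of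
the round `𝕊⁴` (`KillingHopf.exists_orthogonal_quotient` with `V = ℝ⁵`, `n = 4`). Lee 2018,
Thm. 12.4 and Cor. 12.5. [cite: Lee2018, Thm. 12.4 and Cor. 12.5] -/
theorem killingHopf_quotient_four (M : Type) [TopologicalSpace M] [T2Space M]
    [SecondCountableTopology M] [CompactSpace M] [ConnectedSpace M]
    [ChartedSpace (EuclideanSpace ℝ (Fin 4)) M] [IsManifold (𝓡 4) ∞ M] (c : ℝ)
    (g : PseudoRiemannianMetric (𝓡 4) ∞ (EuclideanSpace ℝ (Fin 4)) (TangentSpace (𝓡 4) : M → Type _))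
    (hc : 0 < c) (hg : g.IsRiemannian) (hK : g.HasConstantSectionalCurvature c) :
    ∃ (Γ : Subgroup (EuclideanSpace ℝ (Fin 5) ≃ₗᵢ[ℝ] EuclideanSpace ℝ (Fin 5)))
      (q : Metric.sphere (0 : EuclideanSpace ℝ (Fin 5)) 1 → M),
      (∀ γ ∈ Γ, γ ≠ 1 → ∀ x : Metric.sphere (0 : EuclideanSpace ℝ (Fin 5)) 1,
          γ x ≠ (x : EuclideanSpace ℝ (Fin 5))) ∧
        IsLocalDiffeomorph (𝓡 4) (𝓡 4) ∞ q ∧ Surjective q ∧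
        ∀ x y : Metric.sphere (0 : EuclideanSpace ℝ (Fin 5)) 1,
          q x = q y ↔ ∃ γ ∈ Γ, γ x = (y : EuclideanSpace ℝ (Fin 5)) := by
  haveI : Fact (finrank ℝ (EuclideanSpace ℝ (Fin 5)) = 4 + 1) := ⟨finrank_euclideanSpace_fin⟩
  have p : Metric.sphere (0 : EuclideanSpace ℝ (Fin 5)) 1 :=
    ⟨EuclideanSpace.single 0 1, by simp⟩
  obtain ⟨Γ, q, -, hfree, hloc, hsurj, hfib⟩ :=
    KillingHopf.exists_orthogonal_quotient (V := EuclideanSpace ℝ (Fin 5)) (n := 4) (by norm_num)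
      hc hg hK finrank_euclideanSpace_fin p
  exact ⟨Γ, q, hfree, hloc, hsurj, hfib⟩

/-- **Hamilton's Thm. 1.1 from the convergence of the Ricci flow alone.** With (H2) proved
(`killingHopf_quotient_four`), the reduction
`hamilton_positiveCurvatureOperator_classification_four_of_constantCurvature_of_killingHopf`
leaves exactly one input: (H1) every closed connected smooth 4-manifold with a `C^∞` Riemannian
metric of positive curvature operator carries a `C^∞` Riemannian metric of constant sectional
curvature `c > 0` (Hamilton 1986, p. 154 with 5.2 and Thm. 7.1: the normalised Ricci flow
"exists for all time `t` and converges as `t → ∞` to a metric of constant Riemannian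
curvature"). [cite: Hamilton1986, §1, Thm. 1.1 (p. 153) and p. 154] [cite: Lee2018, Thm. 12.4 and Cor. 12.5] -/
theorem hamilton_positiveCurvatureOperator_classification_four_of_constantCurvature
    (h₁ : ∀ (M : Type) [TopologicalSpace M] [T2Space M] [SecondCountableTopology M]
      [CompactSpace M] [ConnectedSpace M] [ChartedSpace (EuclideanSpace ℝ (Fin 4)) M]
      [IsManifold (𝓡 4) ∞ M],
      (∃ g : PseudoRiemannianMetric (𝓡 4) ∞ (EuclideanSpace ℝ (Fin 4))
          (TangentSpace (𝓡 4) : M → Type _), g.IsRiemannian ∧ g.HasPositiveCurvatureOperator) →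
        ∃ (c : ℝ) (g' : PseudoRiemannianMetric (𝓡 4) ∞ (EuclideanSpace ℝ (Fin 4))
          (TangentSpace (𝓡 4) : M → Type _)),
          0 < c ∧ g'.IsRiemannian ∧ g'.HasConstantSectionalCurvature c) :
    hamilton_positiveCurvatureOperator_classification_four :=
  hamilton_positiveCurvatureOperator_classification_four_of_constantCurvature_of_killingHopf h₁
    fun M _ _ _ _ _ _ _ c g hc hg hK ↦ killingHopf_quotient_four M c g hc hg hK

end Literature.Geometry.Riemannian
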